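import Mathlib
import HarnessLib
import Literature.NumberTheory.Automorphic.HeckeLatticeCount

/-!
# Route MonotoneRestoration — aside `OrbitCompressionQP` (stmt-ValiantsHypothesis-18332), line
# `expression_compression`: elementary symmetric functions of a PUNCTURED ROW

Bookkeeping for the g-form of the pinned-entry strata (`…PinnedEntryRow`, `…TwoPinnedEntriesRow`,
`…PinnedProducts`): a column-symmetric inner polynomial affine in the second row is
`g(r, s) = g₀(r) + Σ_b s_b F(r_b; r_{-b})` with `F` symmetric in the PUNCTURED row `r_{-b}`, while the gadget
theorems take `H(t; r)` symmetric in the FULL row.  The conversion `F(r_b; r_{-b}) = H(r_b; r)` is division-free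
because the elementary symmetric functions of the punctured row are polynomials in the pinned entry and the
elementary symmetric functions of the full row:

  `e_k(r_{-b}) = Σ_{i ≤ k} (−r_b)^i · e_{k−i}(r)`      (`Π_{v ≠ b} (1 + r_v T) = Π_v (1 + r_v T) / (1 + r_b T)`).

* (the cons recursion `esymm (a ::ₘ s) (k+1) = esymm s (k+1) + a · esymm s k` is the tree's
  `Literature.NumberTheory.Automorphic.multiset_esymm_cons_succ`);
* `univ_val_map_eq_cons_succAbove` — the row as the pinned entry consed onto the punctured row;
* `aeval_esymm_succAbove_succ` — the recursion `e_{k+1}(r_{-b}) = e_{k+1}(r) − r_b · e_k(r_{-b})`;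
* ★ `aeval_esymm_succAbove_eq_sum` — the closed form above, for any `f : Fin (m+1) → S`;
* `esymm_puncturedRow` — the matrix instance `f = (x_{i,v})_v`.

Helper file (`--supports stmt-ValiantsHypothesis-18332`); def-free; nothing here is a named fact; no registered
stub is closed; VP ≠ VNP is not moved.
-/

noncomputable section

open MvPolynomial

-- `Summit.ValiantsHypothesis.ValiantsHypothesis.…` is the tree's single-conjunct layout (Sub = Summit).
set_option linter.dupNamespace false

namespace Summit.ValiantsHypothesis.ValiantsHypothesis.Theorems

namespace CoefficientSlices

/-- The row `(f v)_{v : Fin (m+1)}` as a multiset is the pinned entry `f b` consed onto the punctured row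
`(f (b.succAbove j))_{j : Fin m}`. [folklore] -/
theorem univ_val_map_eq_cons_succAbove {S : Type*} {m : ℕ} (f : Fin (m + 1) → S) (b : Fin (m + 1)) :
    (Finset.univ : Finset (Fin (m + 1))).val.map f =
      f b ::ₘ (Finset.univ : Finset (Fin m)).val.map (f ∘ b.succAbove) := by
  rw [Fin.univ_succAbove m b, Finset.cons_val, Multiset.map_cons, Finset.map_val, Multiset.map_map]
  rfl

/-- **Recursion**: `e_{k+1}(r_{-b}) = e_{k+1}(r) − r_b · e_k(r_{-b})`. [folklore] -/
theorem aeval_esymm_succAbove_succ {R S : Type*} [CommRing R] [CommRing S] [Algebra R S] {m : ℕ}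
    (f : Fin (m + 1) → S) (b : Fin (m + 1)) (k : ℕ) :
    aeval (f ∘ b.succAbove) (esymm (Fin m) R (k + 1)) =
      aeval f (esymm (Fin (m + 1)) R (k + 1)) - f b * aeval (f ∘ b.succAbove) (esymm (Fin m) R k) := by
  rw [aeval_esymm_eq_multiset_esymm, aeval_esymm_eq_multiset_esymm, aeval_esymm_eq_multiset_esymm,
    univ_val_map_eq_cons_succAbove f b, Literature.NumberTheory.Automorphic.multiset_esymm_cons_succ]
  ring

/-- ★ **Elementary symmetric functions of a punctured row**: for `f : Fin (m+1) → S` and `b`,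
`e_k((f ∘ succAbove b)) = Σ_{i ≤ k} (−f b)^i · e_{k−i}(f)`. [folklore] -/
theorem aeval_esymm_succAbove_eq_sum {R S : Type*} [CommRing R] [CommRing S] [Algebra R S] {m : ℕ}
    (f : Fin (m + 1) → S) (b : Fin (m + 1)) (k : ℕ) :
    aeval (f ∘ b.succAbove) (esymm (Fin m) R k) =
      ∑ i ∈ Finset.range (k + 1), (-f b) ^ i * aeval f (esymm (Fin (m + 1)) R (k - i)) := by
  induction k with
  | zero => simp [esymm_zero]
  | succ k ih =>
    rw [aeval_esymm_succAbove_succ, ih, Finset.sum_range_succ' _ (k + 1)]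
    simp only [pow_zero, one_mul, Nat.sub_zero, pow_succ, Finset.mul_sum]
    have hterm : ∀ i ∈ Finset.range (k + 1),
        f b * ((-f b) ^ i * aeval f (esymm (Fin (m + 1)) R (k - i))) =
          -((-f b) ^ i * -f b * aeval f (esymm (Fin (m + 1)) R (k + 1 - (i + 1)))) := by
      intro i _
      rw [Nat.add_sub_add_right]
      ring
    rw [Finset.sum_congr rfl hterm, Finset.sum_neg_distrib]
    ring

/-- **Matrix instance**: the elementary symmetric functions of row `i` of the `(m+1) × (m+1)` variable matrix
punctured at column `b` are polynomials in `x_{ib}` and the elementary symmetric functions of the full row.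
[folklore] -/
theorem esymm_puncturedRow {m : ℕ} (i b : Fin (m + 1)) (k : ℕ) :
    aeval (fun j : Fin m => (X (i, b.succAbove j) : MvPolynomial (Fin (m + 1) × Fin (m + 1)) ℂ))
        (esymm (Fin m) ℂ k) =
      ∑ l ∈ Finset.range (k + 1), (-(X (i, b) : MvPolynomial (Fin (m + 1) × Fin (m + 1)) ℂ)) ^ l *
        aeval (fun v : Fin (m + 1) => (X (i, v) : MvPolynomial (Fin (m + 1) × Fin (m + 1)) ℂ))
          (esymm (Fin (m + 1)) ℂ (k - l)) :=
  aeval_esymm_succAbove_eq_sum (R := ℂ)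
    (fun v : Fin (m + 1) => (X (i, v) : MvPolynomial (Fin (m + 1) × Fin (m + 1)) ℂ)) b k

end CoefficientSlices

end Summit.ValiantsHypothesis.ValiantsHypothesis.Theorems

end
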